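import Mathlib
import HarnessLib
import Literature.NumberTheory.LFunctions.ZetaScrew
import Literature.NumberTheory.LFunctions.UniformWeilPositivityRH
import Summits.RiemannHypothesis.RiemannHypothesis.Theorems.HandoffDecomposition
import Summits.RiemannHypothesis.RiemannHypothesis.Theorems.IntegerScrewWeilWindowRatio

/-!
# Route `IntegerScrew` — the WEIL column's HANDOFF LADDER is the PRIME-RATIO ladder of Suzuki's integer
# screw matrices (`H(q) ⟺` ratio-`q⁺` windows of `S_M` are non-negative on balanced vectors; RH-FREE glue,
# EXCEPT the labelled RH-EQUIVALENT `riemannHypothesis_iff_…` statements, which are Weil's criterion re-indexed)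

Track «HANDOFF» of the Weil column types RH as `RH ↔ Base ∧ ∀ q prime, H(q)` with `H(q)` the window
statement for the consecutive pair `(q, q⁺)` (`HandoffDecomposition`: `handoffH_iff_weilPositivityOn`,
`H(q) ↔ WeilPositivityOn ((log q⁺)/2)`; `Base = WeilPositivityOn ((log 2)/2)`; increment form
`HandoffStep q = (WeilPositivityOn ((log q)/2) → H(q))`).  The ratio dictionary of
`IntegerScrewWeilWindowRatio` (`weilPositivityOn_log_half_iff_forall_ratio_window`:
`WeilPositivityOn ((log R)/2) ↔` every window `(N, M]`, `M ≤ R(N+1)`, of the screw matrices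
`S_M = [G(log m, log m')]` is non-negative on balanced real vectors — «ratio `R` is GOOD») turns the
ladder into a statement about integer matrices:

* `handoffBase_iff_ratio_two` — `Base ↔` ratio `2` is good (windows `(N, 2N+2]`; RH-free TRUE,
  `screwWindow_ratio_two`);
* `handoffH_iff_nextPrime_ratio_window` — for `q` prime, **`H(q) ↔` ratio `q⁺` is good**
  (and the tail form `handoffH_iff_eventually_nextPrime_ratio_window`: only `N ≥ N₀` needed);
* `handoffStep_iff_ratio_climb` — `HandoffStep q ↔ (ratio q good → ratio q⁺ good)`: the handoff at `q`
  is exactly the climb of window positivity from ratio `q` to the next prime ratio;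
* `riemannHypothesis_iff_forall_prime_ratio_window` — **RH ↔ every PRIME ratio is good**;
  `riemannHypothesis_iff_ratio_two_and_forall_climb` — RH ↔ ratio `2` good ∧ every prime climb.

In the tree today (RH-free): ratios `≤ 7` are good (`screwWindow_nonneg_of_le_seven_mul`, the rung
`a = 1`), i.e. `H(2)`, `H(3)`, `H(5)` in screw clothing; `H(7)` = ratio `11` is the first open rung
(float-certified in the Weil column's data, not a theorem).  LABEL: RH-FREE glue between two typings of
Weil's criterion; the `∀` statements are RH-EQUIVALENT (labelled).  Nothing here bears on the truth of RH.

References: E. Bombieri, Rend. Lincei (9) 11 (2000) Thm. 2, §4; H. Yoshida, Adv. Stud. Pure Math. 21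
(1992) Prop. 6; M. Suzuki, J. Lond. Math. Soc. (2) 108 (2023) = arXiv:2206.03682, (1.4)–(1.5),
Prop. 3.1 [Suzuki2023].
-/

noncomputable section

-- D-0017: `Summit.<S>.<S>.…` is the designed namespace of a single-problem summit.
set_option linter.dupNamespace false

namespace Summit.RiemannHypothesis.RiemannHypothesis.Theorems.IntegerScrew

open Literature.NumberTheory.LFunctions Finset
open Summit.RiemannHypothesis.RiemannHypothesis.Theorems.HandoffDecomposition

/-- **`Base ↔` ratio `2` is good**: Weil positivity on the zeroth window `[−(log 2)/2, (log 2)/2]` is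
exactly non-negativity of every screw matrix `S_M` on the balanced vectors of every window `(N, M]` with
`M ≤ 2(N+1)`. [cite: Yoshida1992HermitianForms, Thm. 1 (p. 310)] -/
theorem handoffBase_iff_ratio_two :
    HandoffBase ↔ ∀ N M : ℕ, M ≤ 2 * (N + 1) → ∀ x : ℕ → ℝ, ∑ m ∈ Ioc N M, x m = 0 →
      0 ≤ ∑ m ∈ Ioc N M, ∑ m' ∈ Ioc N M,
        zetaScrewKernel (Real.log m) (Real.log m') * (x m * x m') := by
  unfold HandoffBase
  exact_mod_cast weilPositivityOn_log_half_iff_forall_ratio_window 2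

/-- **Ratio `2` is good, RH-FREE** (Yoshida's theorem `handoffBase_holds` in screw clothing): every
window `(N, M]` with `M ≤ 2(N+1)` is non-negative on balanced vectors, for every `M`. [cite: Yoshida1992HermitianForms, Thm. 1 (p. 310)] -/
theorem screwWindow_ratio_two (N M : ℕ) (hNM : M ≤ 2 * (N + 1)) (x : ℕ → ℝ)
    (hx : ∑ m ∈ Ioc N M, x m = 0) :
    0 ≤ ∑ m ∈ Ioc N M, ∑ m' ∈ Ioc N M,
      zetaScrewKernel (Real.log m) (Real.log m') * (x m * x m') :=
  handoffBase_iff_ratio_two.1 handoffBase_holds N M hNM x hx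

/-- **`H(q) ↔` ratio `q⁺` is good** (`q` prime): the handoff condition at `q` — Weil positivity on the
right end `(log q⁺)/2` of the window of `q` — is exactly non-negativity of every `S_M` on the balanced
vectors of every window `(N, M]` with `M ≤ q⁺(N+1)`. [cite: Bombieri2000Weil, §4] -/
theorem handoffH_iff_nextPrime_ratio_window {q : ℕ} (hq : q.Prime) :
    HandoffH q ↔ ∀ N M : ℕ, M ≤ nextPrime q * (N + 1) → ∀ x : ℕ → ℝ, ∑ m ∈ Ioc N M, x m = 0 →
      0 ≤ ∑ m ∈ Ioc N M, ∑ m' ∈ Ioc N M,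
        zetaScrewKernel (Real.log m) (Real.log m') * (x m * x m') := by
  rw [handoffH_iff_weilPositivityOn hq]
  exact weilPositivityOn_log_half_iff_forall_ratio_window (nextPrime q)

/-- Tail form: `H(q) ↔` the ratio-`q⁺` windows are good above some `N₀` (`q` prime).
[cite: Bombieri2000Weil, §4] -/
theorem handoffH_iff_eventually_nextPrime_ratio_window {q : ℕ} (hq : q.Prime) :
    HandoffH q ↔ ∃ N₀ : ℕ, ∀ N M : ℕ, N₀ ≤ N → M ≤ nextPrime q * (N + 1) →
      ∀ x : ℕ → ℝ, ∑ m ∈ Ioc N M, x m = 0 →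
        0 ≤ ∑ m ∈ Ioc N M, ∑ m' ∈ Ioc N M,
          zetaScrewKernel (Real.log m) (Real.log m') * (x m * x m') := by
  rw [handoffH_iff_weilPositivityOn hq]
  exact weilPositivityOn_log_half_iff_eventually_ratio_window (nextPrime q)

/-- **`HandoffStep q ↔` (ratio `q` good → ratio `q⁺` good)** (`q` prime): the increment form of the
handoff ladder is the climb of balanced-window positivity of the screw matrices from the prime ratio
`q` to the next prime ratio `q⁺`. [cite: Yoshida1992HermitianForms, Prop. 6 (p. 320)] -/
theorem handoffStep_iff_ratio_climb {q : ℕ} (hq : q.Prime) :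
    HandoffStep q ↔
      ((∀ N M : ℕ, M ≤ q * (N + 1) → ∀ x : ℕ → ℝ, ∑ m ∈ Ioc N M, x m = 0 →
          0 ≤ ∑ m ∈ Ioc N M, ∑ m' ∈ Ioc N M,
            zetaScrewKernel (Real.log m) (Real.log m') * (x m * x m')) →
        ∀ N M : ℕ, M ≤ nextPrime q * (N + 1) → ∀ x : ℕ → ℝ, ∑ m ∈ Ioc N M, x m = 0 →
          0 ≤ ∑ m ∈ Ioc N M, ∑ m' ∈ Ioc N M,
            zetaScrewKernel (Real.log m) (Real.log m') * (x m * x m')) := by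
  unfold HandoffStep
  rw [weilPositivityOn_log_half_iff_forall_ratio_window q, handoffH_iff_nextPrime_ratio_window hq]

/-- **RH ↔ every PRIME ratio is good** (RH-EQUIVALENT, labelled): RH holds iff for every prime `p`
every window `(N, M]` with `M ≤ p(N+1)` of the integer screw matrices is non-negative on balanced
vectors (`RH ↔ ∀ q prime, H(q)` and `q ↦ q⁺` runs through all odd primes; ratio `2` is RH-free; good
ratios are downward closed, so the prime ratios exhaust all ratios). [cite: Bombieri2000Weil, Thm. 2] -/
theorem riemannHypothesis_iff_forall_prime_ratio_window :
    _root_.RiemannHypothesis ↔ ∀ p : ℕ, p.Prime → ∀ N M : ℕ, M ≤ p * (N + 1) →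
      ∀ x : ℕ → ℝ, ∑ m ∈ Ioc N M, x m = 0 →
        0 ≤ ∑ m ∈ Ioc N M, ∑ m' ∈ Ioc N M,
          zetaScrewKernel (Real.log m) (Real.log m') * (x m * x m') := by
  constructor
  · intro hRH p _ N M _ x hx
    exact (riemannHypothesis_iff_forall_balanced_screwWindow.1 hRH) N M x hx
  · intro h
    refine riemannHypothesis_iff_forall_balanced_screwWindow.2 fun N M x hx => ?_
    -- the window `(N, M]` has ratio `≤ M + 1 ≤ p` for a prime `p ≥ M + 1`
    obtain ⟨p, hMp, hp⟩ := Nat.exists_infinite_primes (M + 1)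
    exact h p hp N M
      ((Nat.le_succ M).trans (hMp.trans (Nat.le_mul_of_pos_right _ (Nat.succ_pos N)))) x hx

/-- **RH ↔ ratio `2` good ∧ every prime climb** (RH-EQUIVALENT, labelled; the increment form
`riemannHypothesis_iff_base_and_forall_handoffStep` in screw clothing): RH holds iff the ratio-`2`
windows are good (RH-free, `screwWindow_ratio_two`) and, for every prime `q`, goodness of ratio `q`
implies goodness of ratio `q⁺`. [cite: Yoshida1992HermitianForms, Prop. 6; Bombieri2000Weil Thm. 2] -/
theorem riemannHypothesis_iff_ratio_two_and_forall_climb :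
    _root_.RiemannHypothesis ↔
      (∀ N M : ℕ, M ≤ 2 * (N + 1) → ∀ x : ℕ → ℝ, ∑ m ∈ Ioc N M, x m = 0 →
          0 ≤ ∑ m ∈ Ioc N M, ∑ m' ∈ Ioc N M,
            zetaScrewKernel (Real.log m) (Real.log m') * (x m * x m')) ∧
        ∀ q : ℕ, q.Prime →
          ((∀ N M : ℕ, M ≤ q * (N + 1) → ∀ x : ℕ → ℝ, ∑ m ∈ Ioc N M, x m = 0 →
              0 ≤ ∑ m ∈ Ioc N M, ∑ m' ∈ Ioc N M,
                zetaScrewKernel (Real.log m) (Real.log m') * (x m * x m')) →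
            ∀ N M : ℕ, M ≤ nextPrime q * (N + 1) → ∀ x : ℕ → ℝ, ∑ m ∈ Ioc N M, x m = 0 →
              0 ≤ ∑ m ∈ Ioc N M, ∑ m' ∈ Ioc N M,
                zetaScrewKernel (Real.log m) (Real.log m') * (x m * x m')) := by
  rw [← Summit.RiemannHypothesis_iff, riemannHypothesis_iff_base_and_forall_handoffStep,
    handoffBase_iff_ratio_two]
  refine and_congr Iff.rfl (forall₂_congr fun q hq => ?_)
  exact handoffStep_iff_ratio_climb hq

/-- **No tail of the prime-ratio ladder is weaker than RH** (RH-EQUIVALENT, labelled; the T3 question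
of RH-PROMISE in screw clothing): for EVERY `Q₀`, RH holds iff every prime ratio `p ≥ Q₀` is good —
good ratios are downward closed, so the large prime ratios already carry every window.
[cite: Bombieri2000Weil, Thm. 2] -/
theorem riemannHypothesis_iff_forall_large_prime_ratio_window (Q₀ : ℕ) :
    _root_.RiemannHypothesis ↔ ∀ p : ℕ, p.Prime → Q₀ ≤ p → ∀ N M : ℕ, M ≤ p * (N + 1) →
      ∀ x : ℕ → ℝ, ∑ m ∈ Ioc N M, x m = 0 →
        0 ≤ ∑ m ∈ Ioc N M, ∑ m' ∈ Ioc N M,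
          zetaScrewKernel (Real.log m) (Real.log m') * (x m * x m') := by
  rw [riemannHypothesis_iff_forall_prime_ratio_window]
  refine ⟨fun h p hp _ => h p hp, fun h p hp N M hNM x hx => ?_⟩
  -- a prime `p' ≥ max p Q₀` dominates the ratio `p`
  obtain ⟨p', hp'ge, hp'⟩ := Nat.exists_infinite_primes (max p Q₀)
  exact h p' hp' ((le_max_right _ _).trans hp'ge) N M
    (hNM.trans (Nat.mul_le_mul_right _ ((le_max_left _ _).trans hp'ge))) x hx

end Summit.RiemannHypothesis.RiemannHypothesis.Theorems.IntegerScrew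

end
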